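import Summits.ValiantsHypothesis.ValiantsHypothesis.Theorems.KPlusLogSqLawTropicalSymmetricOrbitThreeFourSixteenOrient

/-!
# Route «KPlusLogSqLaw» — `TSymOrb34Le16`: rotating the three indices of an abstract orbit chain (`rotate_elim`)

HONEST FRAMING.  Helper file (seat val-sym-lift-p2 (g7), cell `pub-symmetroid`, 2026-08-27; `--supports` the `WeakLifting` item
stmt-ValiantsHypothesis-19561 as a helper, no closure claim).  Bookkeeping for the generated case analysis `core16` («T^orb_sym(3,4) ≤ 16»,
docket R1797/R1798): the abstract 16-interface (shapes, orientation normalisation, M, S, R1w–R3′w, T-triple, P1, P2) is invariant under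
relabelling the three row/column indices by the rotation `finRotate 3` (conjugating carriers, permuting columns), which commutes with the
normalised pair carrier; so the root carrier of each generated case may be taken up to rotation (`rotate_elim`, an eliminator in the style
of `mirror_elim` / `orient_elim`).  No census numeral; `TSymOrb34Le16` NOT asserted here; nothing on `TropicalB` / `WeakLifting` in their
windows, DoorA34 / DoorA26 (OPEN), `MatrixDescartes` (stmt-ValiantsHypothesis-18050) or VP ≠ VNP.  [bookkeeping; seat val-sym-lift-p2 g7]
-/

set_option linter.dupNamespace false
set_option linter.unusedVariables false
set_option linter.unusedSectionVars false
set_option autoImplicit false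

namespace Summit.ValiantsHypothesis.ValiantsHypothesis.Theorems.KPlusLogSqLaw

open Summit.ValiantsHypothesis.ValiantsHypothesis.Theorems.MatrixDescartes.Negative
open Summit.ValiantsHypothesis.ValiantsHypothesis.Theorems.LacunarySymmetroidMatrixDescartes
open Summit.ValiantsHypothesis.ValiantsHypothesis.Theorems.LacunarySymmetroidMatrixDescartes.TropicalCensus
open Summit.ValiantsHypothesis.ValiantsHypothesis.Theorems.LacunarySymmetroidMatrixDescartes.TropicalCensus.Orbit
open Finset

namespace SymmetricOrbitThreeFourSixteen

/-! ## Conjugation by `finRotate 3` on the six carriers (all by `decide`) -/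

/-- conjugating by the rotation: identity carriers. -/
theorem conj_eq_one : ∀ σ : Equiv.Perm (Fin 3), finRotate 3 * σ * (finRotate 3)⁻¹ = 1 ↔ σ = 1 := by decide

/-- conjugating by the rotation: transposition carriers. -/
theorem conj_eq_swap : ∀ (σ : Equiv.Perm (Fin 3)) (i j : Fin 3),
    finRotate 3 * σ * (finRotate 3)⁻¹ = Equiv.swap i j ↔ σ = Equiv.swap ((finRotate 3)⁻¹ i) ((finRotate 3)⁻¹ j) := by decide

/-- conjugating by the rotation: values. -/
theorem conj_apply_eq : ∀ (σ : Equiv.Perm (Fin 3)) (i j : Fin 3),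
    (finRotate 3 * σ * (finRotate 3)⁻¹) i = j ↔ σ ((finRotate 3)⁻¹ i) = (finRotate 3)⁻¹ j := by decide

/-- conjugating by the rotation: fixed-point-free carriers. -/
theorem conj_fpf : ∀ σ : Equiv.Perm (Fin 3), (∀ i, σ i ≠ i) → ∀ i, (finRotate 3 * σ * (finRotate 3)⁻¹) i ≠ i := by decide

/-- conjugating by the rotation keeps the orientation normalisation. -/
theorem conj_norm : ∀ σ : Equiv.Perm (Fin 3), σ ≠ (finRotate 3)⁻¹ → finRotate 3 * σ * (finRotate 3)⁻¹ ≠ (finRotate 3)⁻¹ := by decide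

/-- the rotation is injective on indices (for parity bookkeeping of `l₁ = l₂`). -/
theorem rinv_inj : ∀ i j : Fin 3, (finRotate 3)⁻¹ i = (finRotate 3)⁻¹ j ↔ i = j := by decide

/-- ordered transposition data after rotation. -/
theorem swap_rot : ∀ i j : Fin 3, i < j → ∃ i' j' : Fin 3, i' < j' ∧ finRotate 3 * Equiv.swap i j * (finRotate 3)⁻¹ = Equiv.swap i' j' ∧
    (((finRotate 3)⁻¹ i' = i ∧ (finRotate 3)⁻¹ j' = j) ∨ ((finRotate 3)⁻¹ i' = j ∧ (finRotate 3)⁻¹ j' = i)) := by decide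

/-! ## The eliminator -/

/-- **`rotate_elim`** (WLOG up to rotating the indices).  The chain `R k = (ρ σ_k ρ⁻¹, λ_k ∘ ρ⁻¹)`, `ρ = finRotate 3`, satisfies every
hypothesis of the abstract 16-interface (including the orientation normalisation) with the same class multisets; so anything contradictory
for all rotated chains is contradictory. [bookkeeping: each hypothesis is instantiated at the rotated indices] -/
theorem rotate_elim (r : Fin 18 → Equiv.Perm (Fin 3) × (Fin 3 → Fin 4)) (g : Fin 4 → ℕ)
    (hshape : ∀ k, (r k).1 = 1 ∨ (∃ i j : Fin 3, i < j ∧ (r k).1 = Equiv.swap i j ∧ (r k).2 i = (r k).2 j) ∨ (∀ i, (r k).1 i ≠ i))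
    (hnorm : ∀ k, (r k).1 ≠ (finRotate 3)⁻¹)
    (hM : ∀ a b : Fin 18, a < b → ∀ l₁ l₂ : Fin 3,
      ((r a).1 l₁ = (r b).1 l₂ ∧ l₁ = l₂) ∨ ((r a).1 l₁ = l₂ ∧ (r b).1 l₂ = l₁) → (r a).2 l₁ ≤ (r b).2 l₂)
    (hS : ∀ a b : Fin 18, a < b → TropicalCensus.slope g (r a) < TropicalCensus.slope g (r b))
    (hR1 : ∀ a b : Fin 18, a < b → (r a).1 = 1 → ∀ i j : Fin 3, i ≠ j → (r b).1 = Equiv.swap i j → (r b).2 i = (r b).2 j →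
      g ((r a).2 i) + g ((r a).2 j) < 2 * g ((r b).2 i))
    (hR1' : ∀ a b : Fin 18, a < b → (r b).1 = 1 → ∀ i j : Fin 3, i ≠ j → (r a).1 = Equiv.swap i j → (r a).2 i = (r a).2 j →
      2 * g ((r a).2 i) < g ((r b).2 i) + g ((r b).2 j))
    (hR2 : ∀ a b : Fin 18, a < b → ∀ i j k : Fin 3, i ≠ j → k ≠ i → k ≠ j → (r a).1 = Equiv.swap i j →
      (r a).2 i = (r a).2 j → (r b).1 i = j → (r b).1 j = k → (r b).1 k = i →
      g ((r a).2 k) + g ((r a).2 i) < g ((r b).2 j) + g ((r b).2 k))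
    (hR2' : ∀ a b : Fin 18, a < b → ∀ i j k : Fin 3, i ≠ j → k ≠ i → k ≠ j → (r a).1 i = j → (r a).1 j = k → (r a).1 k = i →
      (r b).1 = Equiv.swap i j → (r b).2 i = (r b).2 j → g ((r a).2 j) + g ((r a).2 k) < g ((r b).2 k) + g ((r b).2 i))
    (hR3 : ∀ a b : Fin 18, a < b → (r a).1 = 1 → ∀ i j k : Fin 3, i ≠ j → k ≠ i → k ≠ j →
      (r b).1 i = j → (r b).1 j = k → (r b).1 k = i → g ((r a).2 i) + g ((r a).2 j) < 2 * g ((r b).2 i))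
    (hR3' : ∀ a b : Fin 18, a < b → (r b).1 = 1 → ∀ i j k : Fin 3, i ≠ j → k ≠ i → k ≠ j →
      (r a).1 i = j → (r a).1 j = k → (r a).1 k = i → 2 * g ((r a).2 i) < g ((r b).2 i) + g ((r b).2 j))
    (hT3 : ∀ a b c : Fin 18, ∀ i j k : Fin 3, i ≠ j → k ≠ i → k ≠ j →
      (r a).1 = Equiv.swap j k → (r a).2 j = (r a).2 k → (r b).1 = Equiv.swap i k → (r b).2 i = (r b).2 k →
      (r c).1 = Equiv.swap i j → (r c).2 i = (r c).2 j →
      ¬ (g ((r c).2 i) + g ((r a).2 j) + g ((r b).2 k) ≤ g ((r a).2 i) + 2 * g ((r a).2 j) ∧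
          g ((r c).2 i) + g ((r a).2 j) + g ((r b).2 k) ≤ g ((r b).2 j) + 2 * g ((r b).2 k) ∧
          g ((r c).2 i) + g ((r a).2 j) + g ((r b).2 k) ≤ g ((r c).2 k) + 2 * g ((r c).2 i) ∧
          g ((r a).2 i) + 2 * g ((r a).2 j) ≤ g ((r a).2 i) + g ((r b).2 j) + g ((r c).2 k) ∧
          g ((r b).2 j) + 2 * g ((r b).2 k) ≤ g ((r a).2 i) + g ((r b).2 j) + g ((r c).2 k) ∧
          g ((r c).2 k) + 2 * g ((r c).2 i) ≤ g ((r a).2 i) + g ((r b).2 j) + g ((r c).2 k)) ∧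
      ¬ (g ((r a).2 i) + g ((r b).2 j) + g ((r c).2 k) ≤ g ((r a).2 i) + 2 * g ((r a).2 j) ∧
          g ((r a).2 i) + g ((r b).2 j) + g ((r c).2 k) ≤ g ((r b).2 j) + 2 * g ((r b).2 k) ∧
          g ((r a).2 i) + g ((r b).2 j) + g ((r c).2 k) ≤ g ((r c).2 k) + 2 * g ((r c).2 i) ∧
          g ((r a).2 i) + 2 * g ((r a).2 j) ≤ g ((r c).2 i) + g ((r a).2 j) + g ((r b).2 k) ∧
          g ((r b).2 j) + 2 * g ((r b).2 k) ≤ g ((r c).2 i) + g ((r a).2 j) + g ((r b).2 k) ∧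
          g ((r c).2 k) + 2 * g ((r c).2 i) ≤ g ((r c).2 i) + g ((r a).2 j) + g ((r b).2 k)))
    (hP1 : ∀ a b : Fin 18, ∀ k : Fin 3, (r a).1 ≠ 1 → (r a).1 k = k → (r b).1 ≠ 1 → (r b).1 k = k →
      (r a).2 k = (r b).2 k → (a.val + b.val) % 2 = 0)
    (hP2 : ∀ e a0 a1 a2 : Fin 18, ∀ κ0 κ1 κ2 : Fin 3, κ0 ≠ κ1 → κ0 ≠ κ2 → κ1 ≠ κ2 → (r e).1 = 1 →
      ((r a0).1 ≠ 1 ∧ (r a0).1 κ0 = κ0 ∧ (r a0).2 κ0 = (r e).2 κ0) →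
      ((r a1).1 ≠ 1 ∧ (r a1).1 κ1 = κ1 ∧ (r a1).2 κ1 = (r e).2 κ1) →
      ((r a2).1 ≠ 1 ∧ (r a2).1 κ2 = κ2 ∧ (r a2).2 κ2 = (r e).2 κ2) → (e.val + a0.val + a1.val + a2.val) % 2 = 1)
    (h : ∀ R : Fin 18 → Equiv.Perm (Fin 3) × (Fin 3 → Fin 4),
      (∀ k, R k = (finRotate 3 * (r k).1 * (finRotate 3)⁻¹, fun i => (r k).2 ((finRotate 3)⁻¹ i))) →
      (∀ k, TropicalCensus.classSym (R k) = TropicalCensus.classSym (r k)) →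
      (∀ k, (R k).1 = 1 ∨ (∃ i j : Fin 3, i < j ∧ (R k).1 = Equiv.swap i j ∧ (R k).2 i = (R k).2 j) ∨ (∀ i, (R k).1 i ≠ i)) →
      (∀ k, (R k).1 ≠ (finRotate 3)⁻¹) →
      (∀ a b : Fin 18, a < b → ∀ l₁ l₂ : Fin 3,
        ((R a).1 l₁ = (R b).1 l₂ ∧ l₁ = l₂) ∨ ((R a).1 l₁ = l₂ ∧ (R b).1 l₂ = l₁) → (R a).2 l₁ ≤ (R b).2 l₂) →
      (∀ a b : Fin 18, a < b → TropicalCensus.slope g (R a) < TropicalCensus.slope g (R b)) →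
      (∀ a b : Fin 18, a < b → (R a).1 = 1 → ∀ i j : Fin 3, i ≠ j → (R b).1 = Equiv.swap i j → (R b).2 i = (R b).2 j →
        g ((R a).2 i) + g ((R a).2 j) < 2 * g ((R b).2 i)) →
      (∀ a b : Fin 18, a < b → (R b).1 = 1 → ∀ i j : Fin 3, i ≠ j → (R a).1 = Equiv.swap i j → (R a).2 i = (R a).2 j →
        2 * g ((R a).2 i) < g ((R b).2 i) + g ((R b).2 j)) →
      (∀ a b : Fin 18, a < b → ∀ i j k : Fin 3, i ≠ j → k ≠ i → k ≠ j → (R a).1 = Equiv.swap i j →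
        (R a).2 i = (R a).2 j → (R b).1 i = j → (R b).1 j = k → (R b).1 k = i →
        g ((R a).2 k) + g ((R a).2 i) < g ((R b).2 j) + g ((R b).2 k)) →
      (∀ a b : Fin 18, a < b → ∀ i j k : Fin 3, i ≠ j → k ≠ i → k ≠ j → (R a).1 i = j → (R a).1 j = k → (R a).1 k = i →
        (R b).1 = Equiv.swap i j → (R b).2 i = (R b).2 j → g ((R a).2 j) + g ((R a).2 k) < g ((R b).2 k) + g ((R b).2 i)) →
      (∀ a b : Fin 18, a < b → (R a).1 = 1 → ∀ i j k : Fin 3, i ≠ j → k ≠ i → k ≠ j →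
        (R b).1 i = j → (R b).1 j = k → (R b).1 k = i → g ((R a).2 i) + g ((R a).2 j) < 2 * g ((R b).2 i)) →
      (∀ a b : Fin 18, a < b → (R b).1 = 1 → ∀ i j k : Fin 3, i ≠ j → k ≠ i → k ≠ j →
        (R a).1 i = j → (R a).1 j = k → (R a).1 k = i → 2 * g ((R a).2 i) < g ((R b).2 i) + g ((R b).2 j)) →
      (∀ a b c : Fin 18, ∀ i j k : Fin 3, i ≠ j → k ≠ i → k ≠ j →
        (R a).1 = Equiv.swap j k → (R a).2 j = (R a).2 k → (R b).1 = Equiv.swap i k → (R b).2 i = (R b).2 k →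
        (R c).1 = Equiv.swap i j → (R c).2 i = (R c).2 j →
        ¬ (g ((R c).2 i) + g ((R a).2 j) + g ((R b).2 k) ≤ g ((R a).2 i) + 2 * g ((R a).2 j) ∧
            g ((R c).2 i) + g ((R a).2 j) + g ((R b).2 k) ≤ g ((R b).2 j) + 2 * g ((R b).2 k) ∧
            g ((R c).2 i) + g ((R a).2 j) + g ((R b).2 k) ≤ g ((R c).2 k) + 2 * g ((R c).2 i) ∧
            g ((R a).2 i) + 2 * g ((R a).2 j) ≤ g ((R a).2 i) + g ((R b).2 j) + g ((R c).2 k) ∧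
            g ((R b).2 j) + 2 * g ((R b).2 k) ≤ g ((R a).2 i) + g ((R b).2 j) + g ((R c).2 k) ∧
            g ((R c).2 k) + 2 * g ((R c).2 i) ≤ g ((R a).2 i) + g ((R b).2 j) + g ((R c).2 k)) ∧
        ¬ (g ((R a).2 i) + g ((R b).2 j) + g ((R c).2 k) ≤ g ((R a).2 i) + 2 * g ((R a).2 j) ∧
            g ((R a).2 i) + g ((R b).2 j) + g ((R c).2 k) ≤ g ((R b).2 j) + 2 * g ((R b).2 k) ∧
            g ((R a).2 i) + g ((R b).2 j) + g ((R c).2 k) ≤ g ((R c).2 k) + 2 * g ((R c).2 i) ∧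
            g ((R a).2 i) + 2 * g ((R a).2 j) ≤ g ((R c).2 i) + g ((R a).2 j) + g ((R b).2 k) ∧
            g ((R b).2 j) + 2 * g ((R b).2 k) ≤ g ((R c).2 i) + g ((R a).2 j) + g ((R b).2 k) ∧
            g ((R c).2 k) + 2 * g ((R c).2 i) ≤ g ((R c).2 i) + g ((R a).2 j) + g ((R b).2 k))) →
      (∀ a b : Fin 18, ∀ k : Fin 3, (R a).1 ≠ 1 → (R a).1 k = k → (R b).1 ≠ 1 → (R b).1 k = k →
        (R a).2 k = (R b).2 k → (a.val + b.val) % 2 = 0) →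
      (∀ e a0 a1 a2 : Fin 18, ∀ κ0 κ1 κ2 : Fin 3, κ0 ≠ κ1 → κ0 ≠ κ2 → κ1 ≠ κ2 → (R e).1 = 1 →
        ((R a0).1 ≠ 1 ∧ (R a0).1 κ0 = κ0 ∧ (R a0).2 κ0 = (R e).2 κ0) →
        ((R a1).1 ≠ 1 ∧ (R a1).1 κ1 = κ1 ∧ (R a1).2 κ1 = (R e).2 κ1) →
        ((R a2).1 ≠ 1 ∧ (R a2).1 κ2 = κ2 ∧ (R a2).2 κ2 = (R e).2 κ2) → (e.val + a0.val + a1.val + a2.val) % 2 = 1) →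
      False) : False := by
  let R : Fin 18 → Equiv.Perm (Fin 3) × (Fin 3 → Fin 4) := fun k => (finRotate 3 * (r k).1 * (finRotate 3)⁻¹, fun i => (r k).2 ((finRotate 3)⁻¹ i))
  have R1 : ∀ k, (R k).1 = finRotate 3 * (r k).1 * (finRotate 3)⁻¹ := fun k => rfl
  have R2 : ∀ k i, (R k).2 i = (r k).2 ((finRotate 3)⁻¹ i) := fun k i => rfl
  have hcs : ∀ k, TropicalCensus.classSym (R k) = TropicalCensus.classSym (r k) := fun k => by
    show TropicalCensus.classSym ((finRotate 3 * (r k).1 * (finRotate 3)⁻¹, fun i => (r k).2 ((finRotate 3)⁻¹ i)) : Equiv.Perm (Fin 3) × (Fin 3 → Fin 4)) = _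
    have e : r k = ((r k).1, (r k).2) := rfl
    conv_rhs => rw [e]
    exact classSym_comp_perm (r k).1 _ (finRotate 3)⁻¹ (r k).2
  -- dictionary
  have d1 : ∀ k, (R k).1 = 1 ↔ (r k).1 = 1 := fun k => by rw [R1]; exact conj_eq_one _
  have dsw : ∀ k (i j : Fin 3), (R k).1 = Equiv.swap i j ↔ (r k).1 = Equiv.swap ((finRotate 3)⁻¹ i) ((finRotate 3)⁻¹ j) := fun k i j => by
    rw [R1]; exact conj_eq_swap _ i j
  have dap : ∀ k (i j : Fin 3), (R k).1 i = j ↔ (r k).1 ((finRotate 3)⁻¹ i) = (finRotate 3)⁻¹ j := fun k i j => by rw [R1]; exact conj_apply_eq _ i j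
  have dne : ∀ i j : Fin 3, i ≠ j → (finRotate 3)⁻¹ i ≠ (finRotate 3)⁻¹ j := fun i j h e => h ((rinv_inj i j).mp e)
  refine h R (fun k => rfl) hcs ?_ ?_ ?_ ?_ ?_ ?_ ?_ ?_ ?_ ?_ ?_ ?_ ?_
  · -- shapes
    intro k
    rcases hshape k with h1 | ⟨i, j, hij, hs, hcc⟩ | hf
    · exact Or.inl ((d1 k).mpr h1)
    · right; left
      obtain ⟨i', j', hlt, hsw, hor⟩ := swap_rot i j hij
      refine ⟨i', j', hlt, by rw [R1, hs]; exact hsw, ?_⟩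
      rw [R2 k i', R2 k j']
      rcases hor with ⟨e1, e2⟩ | ⟨e1, e2⟩
      · rw [e1, e2]; exact hcc
      · rw [e1, e2]; exact hcc.symm
    · right; right; rw [R1]; exact conj_fpf _ hf
  · -- normalisation
    intro k; rw [R1]; exact conj_norm _ (hnorm k)
  · -- M
    intro a b hab l₁ l₂ hcell
    rw [R2, R2]
    apply hM a b hab
    rcases hcell with ⟨h1, h2⟩ | ⟨h1, h2⟩
    · left; refine ⟨?_, by rw [h2]⟩
      have := (dap a l₁ ((R b).1 l₂)).mp h1
      rw [this]; subst h2
      -- (finRotate 3)⁻¹ ((R b).1 l₁) = (r b).1 ((finRotate 3)⁻¹ l₁)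
      have := (dap b l₁ ((R b).1 l₁)).mp rfl
      exact this.symm
    · right; exact ⟨(dap a l₁ l₂).mp h1, (dap b l₂ l₁).mp h2⟩
  · -- S
    intro a b hab
    have e : ∀ k, TropicalCensus.slope g (R k) = TropicalCensus.slope g (r k) := fun k => by
      rw [slope_eq_of_classSym, slope_eq_of_classSym, hcs]
    rw [e, e]; exact hS a b hab
  · -- R1
    intro a b hab ha1 i j hij hb1 hcc
    rw [R2, R2, R2]
    exact hR1 a b hab ((d1 a).mp ha1) _ _ (dne i j hij) ((dsw b i j).mp hb1) (by rw [← R2, ← R2]; exact hcc)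
  · -- R1'
    intro a b hab hb1 i j hij ha1 hcc
    rw [R2, R2, R2]
    exact hR1' a b hab ((d1 b).mp hb1) _ _ (dne i j hij) ((dsw a i j).mp ha1) (by rw [← R2, ← R2]; exact hcc)
  · -- R2
    intro a b hab i j k hij hki hkj ha1 hcc hbi hbj hbk
    rw [R2, R2, R2, R2]
    exact hR2 a b hab _ _ _ (dne i j hij) (dne k i hki) (dne k j hkj) ((dsw a i j).mp ha1) (by rw [← R2, ← R2]; exact hcc)
      ((dap b i j).mp hbi) ((dap b j k).mp hbj) ((dap b k i).mp hbk)
  · -- R2'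
    intro a b hab i j k hij hki hkj hai haj hak hb1 hcc
    rw [R2, R2, R2, R2]
    exact hR2' a b hab _ _ _ (dne i j hij) (dne k i hki) (dne k j hkj) ((dap a i j).mp hai) ((dap a j k).mp haj) ((dap a k i).mp hak)
      ((dsw b i j).mp hb1) (by rw [← R2, ← R2]; exact hcc)
  · -- R3
    intro a b hab ha1 i j k hij hki hkj hbi hbj hbk
    rw [R2, R2, R2]
    exact hR3 a b hab ((d1 a).mp ha1) _ _ _ (dne i j hij) (dne k i hki) (dne k j hkj)
      ((dap b i j).mp hbi) ((dap b j k).mp hbj) ((dap b k i).mp hbk)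
  · -- R3'
    intro a b hab hb1 i j k hij hki hkj hai haj hak
    rw [R2, R2, R2]
    exact hR3' a b hab ((d1 b).mp hb1) _ _ _ (dne i j hij) (dne k i hki) (dne k j hkj)
      ((dap a i j).mp hai) ((dap a j k).mp haj) ((dap a k i).mp hak)
  · -- T3
    intro a b c i j k hij hki hkj ha1 hca hb1 hcb hc1 hcc
    simp only [R2]
    exact hT3 a b c _ _ _ (dne i j hij) (dne k i hki) (dne k j hkj) ((dsw a j k).mp ha1) (by rw [← R2, ← R2]; exact hca)
      ((dsw b i k).mp hb1) (by rw [← R2, ← R2]; exact hcb) ((dsw c i j).mp hc1) (by rw [← R2, ← R2]; exact hcc)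
  · -- P1
    intro a b k ha1 hak hb1 hbk hx
    exact hP1 a b ((finRotate 3)⁻¹ k) (fun e => ha1 ((d1 a).mpr e)) ((dap a k k).mp hak) (fun e => hb1 ((d1 b).mpr e)) ((dap b k k).mp hbk)
      (by rw [← R2, ← R2]; exact hx)
  · -- P2
    intro e a0 a1 a2 κ0 κ1 κ2 h01 h02 h12 he1 h0 h1 h2
    exact hP2 e a0 a1 a2 ((finRotate 3)⁻¹ κ0) ((finRotate 3)⁻¹ κ1) ((finRotate 3)⁻¹ κ2) (dne _ _ h01) (dne _ _ h02) (dne _ _ h12) ((d1 e).mp he1)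
      ⟨fun ee => h0.1 ((d1 a0).mpr ee), (dap a0 κ0 κ0).mp h0.2.1, by rw [← R2, ← R2]; exact h0.2.2⟩
      ⟨fun ee => h1.1 ((d1 a1).mpr ee), (dap a1 κ1 κ1).mp h1.2.1, by rw [← R2, ← R2]; exact h1.2.2⟩
      ⟨fun ee => h2.1 ((d1 a2).mpr ee), (dap a2 κ2 κ2).mp h2.2.1, by rw [← R2, ← R2]; exact h2.2.2⟩

end SymmetricOrbitThreeFourSixteen

end Summit.ValiantsHypothesis.ValiantsHypothesis.Theorems.KPlusLogSqLaw
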